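import Summits.ResolutionOfSingularities.ResolutionOfSingularities.Theorems.HilbertSamuelEliminationSigmaMaxModificationsCorridor3CPFrameLegalityPermissible
import Summits.ResolutionOfSingularities.ResolutionOfSingularities.Theorems.HilbertSamuelEliminationSigmaMaxModificationsCorridor3CPFrameFaceReadingAny
import Literature.RingTheory.KrullDimension.AffineDimension
import Mathlib.RingTheory.KrullDimension.Regular
import HarnessLib

/-!
# [OURS · L1 W4.2] D18 `hread_menu`: a PERMISSIBLE centre through the generators of a FACE of an E-adapted CP frame, of the face's dimension,
# IS READ as `V(X, u_T)` LEGALLY — the centre's prime in `R[X]` lies over the generic point of `V(u_T)` with multiplicity `m`, and the face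
# readings (p552261 / p557353) apply
# (cell res-hironaka, LADDER-RESOLUTION rung L; slot W4.2, crux chain w42 `SigmaMaxModificationsCorridor3` stmt-ResolutionOfSingularities-19249;
# `--supports stmt-ResolutionOfSingularities-19249 --as helper`; res-L1-w42-plan-1 RULING v3.14-42 part 2 (KG)(2) / -44 (KP)(KQ); hand res-D-brk-3
# (gen 7), file F3a of DESIGN 17:06:09Z; uses res-D-pv-060's G7 `exists_mul_mem_pow_of_isNormallyFlat` (p550623) for the multiplicity)

SCHEME-SIDE (universe `0`), 0 `def`s, every declaration PROVED; OURS bookkeeping; NOT a statement of Hironaka's manuscript [Hironaka2017] nor of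
[CossartJannsenSaito2020]/[CossartPiltant2019]. AI-written, weaker than expert review.

* `Ideal.eq_of_le_of_ringKrullDim_quotient_eq` — in a Noetherian local ring, primes `𝔭 ≤ 𝔯` with `dim R/𝔭 = dim R/𝔯 < ∞` are equal.
* **`IsCPFrame.exists_prime_of_face`** — `(R, u, h, φ)` a CP frame of the stage (`δ ≥ 1`), `C` a centre PERMISSIBLE at `x_n` whose stalk ideal,
  read in `B = R[X]/(h)`, CONTAINS `ū_t` for `t ∈ T` (the boundary members cutting out the face, in an E-adapted frame) and with
  `dim 𝒪_{x_n}/𝓘_C + |T| = 3` (the centre IS the face, not a proper sub-germ of it): then the centre's prime `𝔔 ⊂ R[X]` lies over the generic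
  point of `V(u_T)` (`𝔔 ∩ R = (u_T)`), `h` has multiplicity `m` at `𝔔` (`s·h ∈ 𝔔^m`, `s ∉ 𝔔` — from normal flatness along the regular centre,
  060's G7), and `𝓘_C·B = 𝔔·B`.
* **`IsCPFrame.exists_reading_of_face_of_isMinimal_comp`** — hence, with the projected minimality `IsMinimal (u|_T) h` (CP Prop. 2.4 (2); a fact
  candidate), the ADAPTED LEGAL READING `𝓘_C·B = ((u_T) + (X))·B ∧ ∀ i ∈ Icc 1 m, coeff_{m−i} h ∈ (u_T)^i` (p557353);
  **`IsCPFrame.exists_reading_of_face_two`** — the same for `|T| = 2` from FULL minimality alone (p552261; equicharacteristic `R`), and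
  **`IsCPFrame.reading_of_face_univ`** — the point (`T = univ`).

References: CP 2019 Def. 2.7, Prop. 2.3–2.4, Prop. 2.7 [CossartPiltant2019]; CJS LNM 2270 Def. 3.1, Thm. 3.2 (3) [CossartJannsenSaito2020]; Matsumura
Thms. 9.4, 14.2, 23.7 [Matsumura1987].
-/

noncomputable section

set_option linter.dupNamespace false

open CategoryTheory AlgebraicGeometry TopologicalSpace IsLocalRing Polynomial
open Literature.AlgebraicGeometry.Resolution Literature.RingTheory.HilbertSamuel
open Summit.ResolutionOfSingularities.ResolutionOfSingularities.Theorems.CampaignW42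
open Summit.ResolutionOfSingularities.ResolutionOfSingularities.Theorems.SigmaMaxModificationsCorridor3.Helpers

namespace Summit.ResolutionOfSingularities.ResolutionOfSingularities.Theorems.SigmaMaxModificationsCorridor3.Moving

/-- In a Noetherian local ring, primes `𝔭 ≤ 𝔯` with the same finite coheight `dim R/𝔭 = dim R/𝔯 = k` coincide. [cite: Matsumura1987, §5 (p. 31)] -/
theorem Ideal.eq_of_le_of_ringKrullDim_quotient_eq {A : Type*} [CommRing A] [IsNoetherianRing A] [IsLocalRing A] {𝔭 𝔯 : Ideal A}
    [𝔭.IsPrime] [𝔯.IsPrime] (hle : 𝔭 ≤ 𝔯) {k : ℕ} (h𝔭 : ringKrullDim (A ⧸ 𝔭) = k) (h𝔯 : ringKrullDim (A ⧸ 𝔯) = k) : 𝔭 = 𝔯 := by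
  by_contra hne
  obtain ⟨r, hr𝔯, hr𝔭⟩ : ∃ r ∈ 𝔯, r ∉ 𝔭 := Set.not_subset.mp fun h => hne (le_antisymm hle h)
  haveI : IsDomain (A ⧸ 𝔭) := Ideal.Quotient.isDomain 𝔭
  haveI : Nontrivial (A ⧸ 𝔯) := Ideal.Quotient.nontrivial_iff.mpr (Ideal.IsPrime.ne_top ‹_›)
  haveI : IsLocalRing (A ⧸ 𝔭) := IsLocalRing.of_surjective' (Ideal.Quotient.mk 𝔭) Ideal.Quotient.mk_surjective
  haveI : IsLocalRing (A ⧸ 𝔯) := IsLocalRing.of_surjective' (Ideal.Quotient.mk 𝔯) Ideal.Quotient.mk_surjective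
  set rb := Ideal.Quotient.mk 𝔭 r with hrb
  have hrb0 : rb ≠ 0 := fun h0 => hr𝔭 (Ideal.Quotient.eq_zero_iff_mem.mp h0)
  have hrbm : rb ∈ maximalIdeal (A ⧸ 𝔭) := by
    refine (IsLocalRing.mem_maximalIdeal _).mpr fun hu => ?_
    have : IsUnit (Ideal.Quotient.mk 𝔯 r) := by
      obtain ⟨v, hv⟩ := hu.exists_right_inv
      obtain ⟨v, rfl⟩ := Ideal.Quotient.mk_surjective v
      refine isUnit_iff_exists_inv.mpr ⟨Ideal.Quotient.mk 𝔯 v, ?_⟩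
      rw [← map_mul, ← map_one (Ideal.Quotient.mk 𝔯), Ideal.Quotient.eq]
      rw [hrb, ← map_mul, ← map_one (Ideal.Quotient.mk 𝔭), Ideal.Quotient.eq] at hv
      exact hle hv
    exact (Ideal.Quotient.eq_zero_iff_mem.mpr hr𝔯 ▸ this).ne_zero rfl
  -- `dim (A/𝔭)/(r̄) + 1 = dim A/𝔭`
  have h1 := ringKrullDim_quotient_span_singleton_succ_eq_ringKrullDim_of_mem_nonZeroDivisors
    (mem_nonZeroDivisors_of_ne_zero hrb0) hrbm
  -- `A/𝔯` is a quotient of `(A/𝔭)/(r̄)`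
  have h2 : ringKrullDim (A ⧸ 𝔯) ≤ ringKrullDim ((A ⧸ 𝔭) ⧸ Ideal.span {rb}) := by
    refine ringKrullDim_le_of_surjective (Ideal.Quotient.lift (Ideal.span {rb})
      (Ideal.quotientMap 𝔯 (RingHom.id A) (by simpa using hle)) ?_) ?_
    · intro a ha
      obtain ⟨c, rfl⟩ := Ideal.mem_span_singleton'.mp ha
      obtain ⟨c, rfl⟩ := Ideal.Quotient.mk_surjective c
      rw [hrb, ← map_mul, Ideal.quotientMap_mk, RingHom.id_apply]
      exact Ideal.Quotient.eq_zero_iff_mem.mpr (Ideal.mul_mem_left _ _ hr𝔯)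
    · intro y
      obtain ⟨y, rfl⟩ := Ideal.Quotient.mk_surjective y
      exact ⟨Ideal.Quotient.mk _ (Ideal.Quotient.mk 𝔭 y), by simp⟩
  rw [h𝔭] at h1
  rw [h𝔯] at h2
  -- arithmetic in `WithBot ℕ∞`
  obtain ⟨d, hd⟩ : ∃ d : ℕ, ringKrullDim ((A ⧸ 𝔭) ⧸ Ideal.span {rb}) = d := by
    haveI : Nontrivial ((A ⧸ 𝔭) ⧸ Ideal.span {rb}) :=
      Ideal.Quotient.nontrivial_iff.mpr (fun htop => (IsLocalRing.le_maximalIdeal (Ideal.span_singleton_ne_top ((IsLocalRing.mem_maximalIdeal _).mp hrbm)) |> fun hle' => (maximalIdeal.isMaximal _).ne_top (top_le_iff.mp (htop ▸ hle'))))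
    haveI : IsLocalRing ((A ⧸ 𝔭) ⧸ Ideal.span {rb}) := IsLocalRing.of_surjective' (Ideal.Quotient.mk _) Ideal.Quotient.mk_surjective
    exact exists_nat_eq_of_ne_bot_of_ne_top ringKrullDim_ne_bot ringKrullDim_ne_top
  rw [hd] at h1 h2
  have e1 : d + 1 = k := by exact_mod_cast h1
  have e2 : k ≤ d := by exact_mod_cast h2
  omega

/-- [OURS · L1 W4.2] **The prime of a permissible face-centre.** `(R, u, h, φ)` a CP frame of the marked stage with `δ ≥ 1`; `C` permissible at
`x_n` with `ū_t ∈ 𝓘_C·B` for `t ∈ T` and `dim 𝒪_{x_n}/𝓘_{C,x_n} + |T| = 3`. Then there is a prime `𝔔` of `R[X]` with `𝔔 ∩ R = (u_T)`,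
`s·h ∈ 𝔔^m` for some `s ∉ 𝔔`, and `𝓘_C·B = 𝔔·B`. [cite: CossartJannsenSaito2020, Def. 3.1, Thm. 3.2 (3)] [cite: CossartPiltant2019, Def. 2.7 (ii), Prop. 2.3]
[cite: Matsumura1987, Thm. 9.4, Thm. 23.7] -/
theorem IsCPFrame.exists_prime_of_face {s : MarkedStage.{0}} {R : Type} [CommRing R] [IsLocalRing R] {u : Fin 3 → R} {h : R[X]}
    {φ : (s.W.presheaf.stalk s.pt : Type) →+* R[X] ⧸ Ideal.span {h}} (hF : IsCPFrame s R u h φ)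
    (hco : ∀ i < h.natDegree, h.coeff i ∈ maximalIdeal R ^ (h.natDegree - i))
    (C : s.W.IdealSheafData) (hperm : IdealSheafData.IsPermissibleAt C s.pt) (T : Finset (Fin 3))
    (hT : ∀ t ∈ T, Ideal.Quotient.mk (Ideal.span {h}) (Polynomial.C (u t)) ∈ (stalkIdeal C s.pt).map φ)
    (hdimC : ringKrullDim ((s.W.presheaf.stalk s.pt : Type) ⧸ stalkIdeal C s.pt) + T.card = 3) :
    ∃ (𝔔 : Ideal R[X]) (_ : 𝔔.IsPrime), 𝔔.comap (Polynomial.C : R →+* R[X]) = Ideal.span (u '' ↑T) ∧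
      (∃ s' ∉ 𝔔, s' * h ∈ 𝔔 ^ h.natDegree) ∧ (stalkIdeal C s.pt).map φ = 𝔔.map (Ideal.Quotient.mk (Ideal.span {h})) := by
  classical
  have hm : 0 < h.natDegree := hF.natDegree_pos
  obtain ⟨hR, hloc, hdim, hu, hmon, hφl, hflat, hmap, -, -⟩ := hF
  haveI := hR
  haveI : IsLocalRing (AdjoinRoot h) := hloc
  haveI : IsLocallyNoetherian s.W := s.ln
  haveI : IsDomain R := isDomain_of_isRegularLocalRing R
  letI algφ : Algebra (s.W.presheaf.stalk s.pt : Type) (R[X] ⧸ Ideal.span {h}) := φ.toAlgebra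
  haveI : Module.Flat (s.W.presheaf.stalk s.pt : Type) (R[X] ⧸ Ideal.span {h}) := hflat
  haveI : IsLocalHom (algebraMap (s.W.presheaf.stalk s.pt : Type) (R[X] ⧸ Ideal.span {h})) := hφl
  set I : Ideal (s.W.presheaf.stalk s.pt : Type) := stalkIdeal C s.pt with hI
  have hpermI : I.IsPermissible := hperm
  haveI : IsRegularLocalRing ((s.W.presheaf.stalk s.pt : Type) ⧸ I) := hpermI.isRegularLocalRing
  -- `𝔓 = 𝓘 B` is a regular prime, normally flat
  set 𝔓 : Ideal (R[X] ⧸ Ideal.span {h}) := I.map φ with h𝔓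
  have hNF : 𝔓.IsNormallyFlat := hpermI.isNormallyFlat.map_of_flat (B := R[X] ⧸ Ideal.span {h})
  obtain ⟨hregP, hdimP⟩ := isRegularLocalRing_quotient_map_of_flat (O := (s.W.presheaf.stalk s.pt : Type)) (B := R[X] ⧸ Ideal.span {h})
    hmap I hpermI.ne_top
  have h𝔓eq : I.map (algebraMap (s.W.presheaf.stalk s.pt : Type) (R[X] ⧸ Ideal.span {h})) = 𝔓 := rfl
  rw [h𝔓eq] at hregP hdimP
  haveI := hregP
  haveI hreg' : IsRegularLocalRing (AdjoinRoot h ⧸ (I.map φ : Ideal (AdjoinRoot h))) := hregP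
  haveI hdom : IsDomain (AdjoinRoot h ⧸ (I.map φ : Ideal (AdjoinRoot h))) := isDomain_of_isRegularLocalRing _
  haveI h𝔓p' : (I.map φ : Ideal (AdjoinRoot h)).IsPrime := (Ideal.Quotient.isDomain_iff_prime _).mp hdom
  haveI h𝔓p : 𝔓.IsPrime := h𝔓p'
  -- the multiplicity at `𝔓` (G7, normal flatness)
  obtain ⟨s', hs', hs'h⟩ := exists_mul_mem_pow_of_isNormallyFlat hmon hm hco (I.map φ : Ideal (AdjoinRoot h)) hNF
  set 𝔔 : Ideal R[X] := 𝔓.comap (Ideal.Quotient.mk (Ideal.span {h})) with h𝔔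
  haveI h𝔔p : 𝔔.IsPrime := Ideal.comap_isPrime _ _
  have h𝔔map : 𝔔.map (Ideal.Quotient.mk (Ideal.span {h})) = 𝔓 := Ideal.map_comap_of_surjective _ Ideal.Quotient.mk_surjective 𝔓
  -- `𝔔 ∩ R = (u_T)` by dimension count
  set z : Fin T.card → R := u ∘ (fun i => T.orderEmbOfFin rfl i) with hz
  have hzr : Set.range z = u '' ↑T := by
    rw [hz, Set.range_comp]
    exact congrArg _ (Finset.range_orderEmbOfFin T rfl)
  have hzu : IsRsopPart u := ⟨hR, 0, Fin.elim0, by rw [hdim]; rfl, by rw [← hu]; congr 1; ext w; simp⟩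
  have hzT : IsRsopPart z := hzu.comp _ (T.orderEmbOfFin rfl).injective
  haveI h𝔭p : (Ideal.span (u '' ↑T)).IsPrime := by rw [← hzr]; exact hzT.isPrime_span_range
  have hdim𝔭 : ringKrullDim (R ⧸ Ideal.span (u '' ↑T)) = ((3 - T.card : ℕ) : WithBot ℕ∞) := by
    rw [← hzr]
    have h1 := hzT.ringKrullDim_quotient_add
    rw [hdim] at h1
    haveI : Nontrivial (R ⧸ Ideal.span (Set.range z)) := Ideal.Quotient.nontrivial_iff.mpr hzT.span_range_ne_top
    haveI : IsLocalRing (R ⧸ Ideal.span (Set.range z)) := IsLocalRing.of_surjective' (Ideal.Quotient.mk _) Ideal.Quotient.mk_surjective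
    obtain ⟨d, hd⟩ : ∃ d : ℕ, ringKrullDim (R ⧸ Ideal.span (Set.range z)) = d :=
      exists_nat_eq_of_ne_bot_of_ne_top ringKrullDim_ne_bot ringKrullDim_ne_top
    rw [hd] at h1 ⊢
    have : d + T.card = 3 := by exact_mod_cast h1
    exact_mod_cast (show d = 3 - T.card by omega)
  -- the contraction `𝔯 = 𝔓 ∩ R`
  set 𝔯 : Ideal R := 𝔓.comap (algebraMap R (R[X] ⧸ Ideal.span {h})) with h𝔯
  haveI h𝔯p : 𝔯.IsPrime := Ideal.comap_isPrime _ _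
  have h𝔯eq : 𝔔.comap (Polynomial.C : R →+* R[X]) = 𝔯 := by
    rw [h𝔔, Ideal.comap_comap]
    rfl
  have hle : Ideal.span (u '' ↑T) ≤ 𝔯 := by
    rw [Ideal.span_le]
    rintro _ ⟨t, ht, rfl⟩
    rw [SetLike.mem_coe, h𝔯, Ideal.mem_comap]
    exact hT t (Finset.mem_coe.mp ht)
  have hdim𝔯 : ringKrullDim (R ⧸ 𝔯) = ((3 - T.card : ℕ) : WithBot ℕ∞) := by
    -- `R/𝔯 ⊆ B/𝔓` is integral (`B` is finite over `R`)
    haveI : Module.Finite R (R[X] ⧸ Ideal.span {h}) := hmon.finite_adjoinRoot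
    haveI : Algebra.IsIntegral R (R[X] ⧸ Ideal.span {h}) := Algebra.IsIntegral.of_finite R _
    have h1 := Literature.RingTheory.KrullDimension.ringKrullDim_eq_of_isIntegral (R := R ⧸ 𝔯) (S := (R[X] ⧸ Ideal.span {h}) ⧸ 𝔓)
      Ideal.algebraMap_quotient_injective
    rw [h1, hdimP]
    -- `dim 𝒪/𝓘 = 3 - |T|`
    haveI : Nontrivial ((s.W.presheaf.stalk s.pt : Type) ⧸ I) := Ideal.Quotient.nontrivial_iff.mpr hpermI.ne_top
    haveI : IsLocalRing ((s.W.presheaf.stalk s.pt : Type) ⧸ I) := IsLocalRing.of_surjective' (Ideal.Quotient.mk _) Ideal.Quotient.mk_surjective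
    obtain ⟨d, hd⟩ : ∃ d : ℕ, ringKrullDim ((s.W.presheaf.stalk s.pt : Type) ⧸ I) = d :=
      exists_nat_eq_of_ne_bot_of_ne_top ringKrullDim_ne_bot ringKrullDim_ne_top
    rw [hd] at hdimC ⊢
    have : d + T.card = 3 := by exact_mod_cast hdimC
    exact_mod_cast (show d = 3 - T.card by omega)
  have h𝔯T : 𝔯 = Ideal.span (u '' ↑T) := (Ideal.eq_of_le_of_ringKrullDim_quotient_eq hle hdim𝔭 hdim𝔯).symm
  refine ⟨𝔔, h𝔔p, h𝔯eq.trans h𝔯T, ⟨s', hs', hs'h⟩, h𝔔map.symm⟩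

/-- [OURS · L1 W4.2] **`hread_menu`, any codimension, modulo projected minimality**: a permissible face-centre of an E-adapted CP frame is read as
`V(X, u_T)` LEGALLY, given `IsMinimal (u|_T) h` (CP Prop. 2.4 (2) for the minimal frame; fact candidate `CossartPiltant2019_prop_2_4_projection`).
[cite: CossartPiltant2019, Prop. 2.3–2.4, Prop. 2.7 (arXiv v1 pp. 11–14)] [cite: CossartJannsenSaito2020, Def. 3.1, Thm. 3.2 (3)] -/
theorem IsCPFrame.exists_reading_of_face_of_isMinimal_comp {s : MarkedStage.{0}} {R : Type} [CommRing R] [IsLocalRing R] {u : Fin 3 → R}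
    {h : R[X]} {φ : (s.W.presheaf.stalk s.pt : Type) →+* R[X] ⧸ Ideal.span {h}} (hF : IsCPFrame s R u h φ)
    (hco : ∀ i < h.natDegree, h.coeff i ∈ maximalIdeal R ^ (h.natDegree - i))
    (C : s.W.IdealSheafData) (hperm : IdealSheafData.IsPermissibleAt C s.pt) (T : Finset (Fin 3))
    (hT : ∀ t ∈ T, Ideal.Quotient.mk (Ideal.span {h}) (Polynomial.C (u t)) ∈ (stalkIdeal C s.pt).map φ)
    (hdimC : ringKrullDim ((s.W.presheaf.stalk s.pt : Type) ⧸ stalkIdeal C s.pt) + T.card = 3)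
    (hminT : CossartPiltant.IsMinimal (u ∘ (fun i => T.orderEmbOfFin rfl i)) h) :
    (stalkIdeal C s.pt).map φ =
        ((Ideal.span (u '' ↑T)).map (Polynomial.C : R →+* R[X]) ⊔ Ideal.span {X}).map (Ideal.Quotient.mk (Ideal.span {h})) ∧
      ∀ i ∈ Finset.Icc 1 h.natDegree, h.coeff (h.natDegree - i) ∈ Ideal.span (u '' ↑T) ^ i := by
  have hm : 0 < h.natDegree := hF.natDegree_pos
  obtain ⟨𝔔, h𝔔p, h𝔔R, hord, h𝔔B⟩ := hF.exists_prime_of_face hco C hperm T hT hdimC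
  obtain ⟨hR, -, hdim, hu, hmon, -⟩ := hF
  haveI := hR
  obtain ⟨h𝔔eq, hleg⟩ := eq_span_and_coeff_mem_pow_of_isMinimal_comp hdim u hu hmon hm T hminT 𝔔 h𝔔R hord
  exact ⟨by rw [h𝔔B, h𝔔eq], hleg⟩

/-- [OURS · L1 W4.2] **`hread_menu` for CURVE faces (`|T| = 2`) — UNCONDITIONAL**: a permissible face-centre of codimension two of an E-adapted
MINIMAL CP frame over an equicharacteristic base is read as `V(X, u_T)` LEGALLY (p552261, from the full minimality clause of `IsCPFrame`).
[cite: CossartPiltant2019, Prop. 2.3, Prop. 2.7 (arXiv v1 pp. 11–14)] [cite: CossartJannsenSaito2020, Def. 3.1, Thm. 3.2 (3)] -/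
theorem IsCPFrame.exists_reading_of_face_two {s : MarkedStage.{0}} {R : Type} [CommRing R] [IsLocalRing R] {u : Fin 3 → R}
    {h : R[X]} {φ : (s.W.presheaf.stalk s.pt : Type) →+* R[X] ⧸ Ideal.span {h}} (hF : IsCPFrame s R u h φ)
    (hchar : ∀ k : ℕ, (k : R) ≠ 0 → IsUnit (k : R))
    (hco : ∀ i < h.natDegree, h.coeff i ∈ maximalIdeal R ^ (h.natDegree - i))
    (C : s.W.IdealSheafData) (hperm : IdealSheafData.IsPermissibleAt C s.pt) (T : Finset (Fin 3)) (hT2 : T.card = 2)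
    (hT : ∀ t ∈ T, Ideal.Quotient.mk (Ideal.span {h}) (Polynomial.C (u t)) ∈ (stalkIdeal C s.pt).map φ)
    (hdimC : ringKrullDim ((s.W.presheaf.stalk s.pt : Type) ⧸ stalkIdeal C s.pt) + T.card = 3) :
    (stalkIdeal C s.pt).map φ =
        ((Ideal.span (u '' ↑T)).map (Polynomial.C : R →+* R[X]) ⊔ Ideal.span {X}).map (Ideal.Quotient.mk (Ideal.span {h})) ∧
      ∀ i ∈ Finset.Icc 1 h.natDegree, h.coeff (h.natDegree - i) ∈ Ideal.span (u '' ↑T) ^ i := by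
  classical
  have hm : 0 < h.natDegree := hF.natDegree_pos
  obtain ⟨𝔔, h𝔔p, h𝔔R, hord, h𝔔B⟩ := hF.exists_prime_of_face hco C hperm T hT hdimC
  obtain ⟨hR, -, hdim, hu, hmon, -, -, -, -, hmin⟩ := hF
  haveI := hR
  -- the missing index
  have hcc : Tᶜ.card = 1 := by
    have := Finset.card_add_card_compl T
    rw [Fintype.card_fin, hT2] at this
    omega
  obtain ⟨i₀, hi₀⟩ := Finset.card_eq_one.mp hcc
  have hi₀T : i₀ ∉ T := by
    have : i₀ ∈ Tᶜ := hi₀ ▸ Finset.mem_singleton_self i₀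
    exact Finset.mem_compl.mp this
  have hTi : ∀ j, j ∉ T → j = i₀ := fun j hj => by
    have : j ∈ Tᶜ := Finset.mem_compl.mpr hj
    rw [hi₀] at this
    exact Finset.mem_singleton.mp this
  obtain ⟨h𝔔eq, hleg⟩ := eq_span_and_coeff_mem_pow_of_isMinimal_of_mul_mem_pow hchar hdim u hu hmon hm hmin T i₀ hi₀T hTi 𝔔 h𝔔R hord
  exact ⟨by rw [h𝔔B, h𝔔eq], hleg⟩

/-- [OURS · L1 W4.2] **`hread_menu` for the POINT (`T = univ`)**: a permissible centre of dimension `0` is the closed point, read as `V(X, u)` with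
legality `= δ ≥ 1`. [cite: CossartJannsenSaito2020, Def. 3.1] [cite: CossartPiltant2019, Prop. 2.7] -/
theorem IsCPFrame.reading_of_face_univ {s : MarkedStage.{0}} {R : Type} [CommRing R] [IsLocalRing R] {u : Fin 3 → R}
    {h : R[X]} {φ : (s.W.presheaf.stalk s.pt : Type) →+* R[X] ⧸ Ideal.span {h}} (hF : IsCPFrame s R u h φ)
    (hco : ∀ i < h.natDegree, h.coeff i ∈ maximalIdeal R ^ (h.natDegree - i))
    (C : s.W.IdealSheafData) (hperm : IdealSheafData.IsPermissibleAt C s.pt)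
    (hdimC : ringKrullDim ((s.W.presheaf.stalk s.pt : Type) ⧸ stalkIdeal C s.pt) = 0) :
    (stalkIdeal C s.pt).map φ =
        ((Ideal.span (u '' ↑(Finset.univ : Finset (Fin 3)))).map (Polynomial.C : R →+* R[X]) ⊔ Ideal.span {X}).map
          (Ideal.Quotient.mk (Ideal.span {h})) ∧
      ∀ i ∈ Finset.Icc 1 h.natDegree, h.coeff (h.natDegree - i) ∈ Ideal.span (u '' ↑(Finset.univ : Finset (Fin 3))) ^ i := by
  have hm : 0 < h.natDegree := hF.natDegree_pos
  obtain ⟨hR, hloc, hdim, hu, hmon, hφl, hflat, hmap, -, -⟩ := hF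
  haveI := hR
  haveI : IsLocalRing (AdjoinRoot h) := hloc
  haveI : IsLocallyNoetherian s.W := s.ln
  rw [Finset.coe_univ, Set.image_univ, hu]
  -- a permissible centre of dimension `0` at `x_n` is the closed point
  set I : Ideal (s.W.presheaf.stalk s.pt : Type) := stalkIdeal C s.pt with hI
  have hpermI : I.IsPermissible := hperm
  haveI : IsRegularLocalRing ((s.W.presheaf.stalk s.pt : Type) ⧸ I) := hpermI.isRegularLocalRing
  have hIm : I = maximalIdeal _ := by
    haveI : IsDomain ((s.W.presheaf.stalk s.pt : Type) ⧸ I) := isDomain_of_isRegularLocalRing _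
    haveI : Ring.KrullDimLE 0 ((s.W.presheaf.stalk s.pt : Type) ⧸ I) := Ring.krullDimLE_iff.mpr (by rw [hdimC]; rfl)
    have hbot : (⊥ : Ideal ((s.W.presheaf.stalk s.pt : Type) ⧸ I)).IsMaximal :=
      Ring.krullDimLE_zero_iff.mp inferInstance ⊥ Ideal.isPrime_bot
    have hfield : IsField ((s.W.presheaf.stalk s.pt : Type) ⧸ I) := Ring.isField_iff_maximal_bot.mpr hbot
    exact IsLocalRing.eq_maximalIdeal (Ideal.Quotient.maximal_of_isField I hfield)
  refine ⟨?_, fun i hi => ?_⟩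
  · rw [hIm, hmap, maximalIdeal_quotient_eq_frameIdeal hu hmon hm (fun i hi => Ideal.pow_le_self (by omega) (hco i hi)), hu]
  · have hi' := Finset.mem_Icc.mp hi
    have := hco (h.natDegree - i) (by omega)
    rwa [show h.natDegree - (h.natDegree - i) = i by omega] at this

end Summit.ResolutionOfSingularities.ResolutionOfSingularities.Theorems.SigmaMaxModificationsCorridor3.Moving

end
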